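import Mathlib
import HarnessLib
import Summits.FinalStateConjecture.FinalStateConjecture.Theses.SwallowTheDatum
import Literature.Geometry.Lorentzian.KerrData
import Literature.Geometry.Lorentzian.KerrConvergence
import Literature.Geometry.Lorentzian.CauchyDevelopment
import Literature.Geometry.Lorentzian.InitialDataPullback

/-!
# Sketch — first lemmas of three further crux ideas for `SwallowTheDatum.ParametricKerrBurial`
(planner crux-ideate, ideator 3 / generation 2, round 1). Nothing here is proved; every
`def … : Prop` must elaborate. Namespace is scratch (`…Sketch3G2`, disjoint from the gen-1 file
`Ideator3Sketch.lean`).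

* Card `critical-bag-settled-lid`: `IsNearKruskalThroat`, `CriticalBagSeed`, `Kerr.stripBackground`,
  `TimeSymmetricSeedsSettleWithStrip`.
* Card `continuity-suffices-kid-free-charts`: `SmoothSectionsOfSubmersions` (pure functional
  analysis, Mathlib only).
* WITHDRAWN lever `quasi-spherical-flat-design` (not filed; see NOTES.md §Barrier notes — the
  radial momentum system is elliptic exactly where the mass must be pumped): `IsQuasiSphericalAt`,
  `QuasiSphericalCoffin` kept for the record as the first checkable statement of that lever.
-/

noncomputable section

open scoped Manifold ContDiff Topology
open Set Filter Literature.Geometry.Lorentzian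

namespace Summit.FinalStateConjecture.FinalStateConjecture.Cruxes.ParametricKerrBurial.Sketch3G2

/-! ### Card `critical-bag-settled-lid` -/

/-- `D` (a datum on `E3 = ℝ³`, read in would-be isotropic coordinates) is **`ε`-close to the
two-sided Kruskal time-symmetric slice of mass `M` on the near-throat region**
`{‖x‖ > (M/2)(1 − β)}`: `k ≡ 0` there and `h` is `ε`-close, relatively and pointwise, to the
isotropic Schwarzschild metric `(1 + M/(2‖x‖))⁴ δ` (throat at `‖x‖ = M/2`; the shell
`(M/2)(1−β) < ‖x‖ < M/2` is a collar of the SECOND sheet). `C⁰` form only — the card asks for the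
`Cᵏ`/weighted-Sobolev form. -/
def IsNearKruskalThroat (M β ε : ℝ) (D : InitialDataSet (𝓡 3) E3) : Prop :=
  ∀ x : E3, M / 2 * (1 - β) < ‖x‖ →
    D.k x = 0 ∧
      ∀ v w : E3,
        |D.h.inner x v w - (1 + M / (2 * ‖x‖)) ^ 4 * inner ℝ v w| ≤
          ε * (1 + M / (2 * ‖x‖)) ^ 4 * (‖v‖ * ‖w‖)

/-- **Critical bag seeds** (Beig–Ó Murchadha asymptotics, card `critical-bag-settled-lid`, K1):
for every collar depth `β ∈ (0,1)` and tolerance `ε > 0` there is a COMPLETE, ONE-ENDED, smooth,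
time-symmetric vacuum datum on `ℝ³` (admissible in the typed DR sense) which on
`{‖x‖ > (M/2)(1−β)}` is `ε`-close to the Kruskal `t = 0` slice of mass `M` — right end, throat AND
a collar of the second sheet — the "concentrated gravitational radiation" being sealed in the
compact bag `{‖x‖ ≤ (M/2)(1−β)}`. (Source: critical sequences `λ₁ → 0⁺` of the conformal
Laplacian; `Φ = Ω^{-1/2} + μₙ/2 + μₙ O(Ω^{1/2}) + O(μₙ^{-ε})`, Beig–Ó Murchadha CQG 11 (1994)
(3.16)–(3.17), PRL 66 (1991) 2421.) -/
def CriticalBagSeed : Prop :=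
  ∀ (β ε : ℝ), 0 < β → β < 1 → 0 < ε →
    ∃ (M : ℝ) (D : InitialDataSet (𝓡 3) E3),
      0 < M ∧ D ∈ admissibleVacuumData E3 ∧ (∀ x : E3, D.k x = 0) ∧ IsNearKruskalThroat M β ε D

/-- The **Kerr reference background extended by an interior strip**: ingoing Kerr–Schild
components on `{r > r₊(M,a)(1 − δ)}` (time `t* = x⁰`, radius the Kerr–Schild `r`), i.e. the
region `ᶦⁿᵗ𝓜 ∪ ᵉˣᵗ𝓜` of Klainerman–Szeftel bounded inside the hole by the spacelike hypersurface
`𝓐 = {r = r₊(1 − δ_𝓗)}` (KS 2023 §3.1.1, §3.2.1), instead of the exterior `{r > r₊}` of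
`Kerr.background`. -/
def Kerr.stripBackground (M a δ : ℝ) : ModelBackground where
  domain := Kerr.region a (Kerr.rPlus M a * (1 - δ))
  bilin := Kerr.bilin M a
  time x := x 0
  radius := Kerr.radius a

/-- **Time-symmetric near-Kruskal seeds settle, with an interior strip** (card
`critical-bag-settled-lid`, K2; consequence form of Klainerman–Szeftel 2023 Main Theorem §3.4.3
items 3–4 / GKS 2022, with Klainerman–Nicolò for the far exterior and Cauchy stability to pass
from the time-symmetric slice to a horizon-penetrating initial layer — NOT the prelude's
`klainerman_szeftel_kerr_stability_small_a_cauchy`, which records exterior convergence only):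
there are an order `k` and a strip depth `δ > 0` such that for every mass `M` there are `β, ε`
with: every admissible time-symmetric datum on `ℝ³` which is `ε`-close to the Kruskal slice of
mass `M` on `{‖x‖ > (M/2)(1−β)}` (whatever it is inside the bag) has, in every maximal vacuum
Cauchy development, a region converging in `Cᵏ` — in the Kerr–Schild pullback gauge of a nearby
sub-extremal `Kerr(M', a')` — on the EXTENDED late region `{t* > τ₀, r > r₊(M',a')(1 − δ)}`,
which reaches inside the event horizon. -/
def TimeSymmetricSeedsSettleWithStrip : Prop :=
  ∃ (k : ℕ) (δ : ℝ), 0 < δ ∧ δ < 1 ∧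
    ∀ M : ℝ, 0 < M → ∃ (β ε : ℝ), 0 < β ∧ β < 1 ∧ 0 < ε ∧
      ∀ D : InitialDataSet (𝓡 3) E3, D ∈ admissibleVacuumData E3 → (∀ x : E3, D.k x = 0) →
        IsNearKruskalThroat M β ε D →
        ∀ 𝒟 : VacuumCauchyDevelopment D, 𝒟.IsMaximal →
          ∃ (M' a' : ℝ) (𝒟oc : Set 𝒟.carrier), Kerr.IsSubextremal M' a' ∧
            |M' - M| + |a'| ≤ δ * M ∧
            𝒟.toSpacetime.ConvergesTo (Kerr.stripBackground M' a' δ) 𝒟oc k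

/-! ### Card `continuity-suffices-kid-free-charts` -/

/-- **Continuous sections of a smooth family of submersions can be smoothed rel endpoints**
(card `continuity-suffices-kid-free-charts`, K1 — the abstract Banach-space lemma behind
"Lipschitz dependence of the gluing is enough"): `Φ : ℝ × E → F` smooth, `γ` a continuous path of
zeros `Φ(s, γ s) = 0` on `[0,1]` along which the partial derivative `D₂Φ` admits a continuous
linear right inverse (in the application: no KIDs on the transition zone, Chruściel–Delay);
then `γ` is `ε`-shadowed by a `C^∞` path of zeros with the same endpoints. -/
def SmoothSectionsOfSubmersions : Prop :=
  ∀ (E F : Type) [NormedAddCommGroup E] [NormedSpace ℝ E] [CompleteSpace E]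
    [NormedAddCommGroup F] [NormedSpace ℝ F] [CompleteSpace F]
    (Φ : ℝ × E → F), ContDiff ℝ ((⊤ : ℕ∞) : WithTop ℕ∞) Φ →
    ∀ γ : ℝ → E, ContinuousOn γ (Icc 0 1) → (∀ s ∈ Icc (0 : ℝ) 1, Φ (s, γ s) = 0) →
      (∀ s ∈ Icc (0 : ℝ) 1, ∃ R : F →L[ℝ] E,
        (fderiv ℝ (fun v : E ↦ Φ (s, v)) (γ s)).comp R = ContinuousLinearMap.id ℝ F) →
      ∀ ε : ℝ, 0 < ε →
        ∃ γ' : ℝ → E, ContDiff ℝ ((⊤ : ℕ∞) : WithTop ℕ∞) γ' ∧ γ' 0 = γ 0 ∧ γ' 1 = γ 1 ∧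
          ∀ s ∈ Icc (0 : ℝ) 1, Φ (s, γ' s) = 0 ∧ ‖γ' s - γ s‖ < ε

/-! ### Card `quasi-spherical-flat-design` -/

/-- The datum `W` on `{‖y‖ > ρ} ⊂ ℝ³` is **quasi-spherical at `y`** (Bartnik 1993): the
coordinate sphere through `y` is ROUND of area `4π‖y‖²` for `h`, i.e. `h_y(v,v) = ‖v‖²` for
every `v ⊥ y`. (Kerr–Schild slices of Schwarzschild are quasi-spherical: `h = δ + 2H ℓ♭⊗ℓ♭` with
`ℓ` radial.) -/
def IsQuasiSphericalAt {ρ : ℝ} (W : InitialDataSet 𝓘(ℝ, E3) (Kerr.slice 0 ρ))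
    (y : Kerr.slice 0 ρ) : Prop :=
  ∀ v : E3, inner ℝ (y : E3) v = 0 → W.h.inner y v v = ‖v‖ ^ 2

/-- **Quasi-spherical coffin** (card `quasi-spherical-flat-design`, K1): for every floor ratio
`η > 0` there is ONE smooth vacuum datum on `{‖y‖ > ρ}` in Bartnik's quasi-spherical gauge which
IS the Kerr–Schild slice datum of Schwarzschild(`μ`), `0 < μ < ηρ`, on the floor annulus
`{ρ < ‖y‖ < 2ρ}` and IS the Kerr–Schild slice datum of Schwarzschild(`M`) on `{‖y‖ > r_c}` with
`r_c < 2M` (a TRAPPED collar: the lid enters the black hole; re-slicing the exact region along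
the crux's hard-coded `T` is the route's standard step). Intended construction: prescribe the
radial paths of `(u, ω)`, solve the remaining constraint unknowns sphere-by-sphere
(algebraic / `div` on `S²` / transport in `r`), dock onto the Kerr–Schild trajectory by flat
matching, absorb the conserved monopole in the choice of `M`. -/
def QuasiSphericalCoffin : Prop :=
  ∀ [Kerr.Facts] [Kerr.SliceFacts], ∀ η : ℝ, 0 < η →
    ∃ (μ ρ M r_c : ℝ) (hμ : 0 < μ) (hM : 0 < M)
      (W : InitialDataSet 𝓘(ℝ, E3) (Kerr.slice 0 ρ)),
      0 < ρ ∧ μ < η * ρ ∧ 2 * ρ < r_c ∧ r_c < 2 * M ∧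
      (∀ [W.metric.HasLeviCivita], W.IsVacuumConstraintSolution) ∧
      (∀ y : Kerr.slice 0 ρ, IsQuasiSphericalAt W y) ∧
      (∀ y : Kerr.slice 0 ρ, ‖(y : E3)‖ < 2 * ρ →
        W.h.inner y = (Kerr.data μ 0 ρ hμ.le).h.inner y ∧ W.k y = (Kerr.data μ 0 ρ hμ.le).k y) ∧
      (∀ y : Kerr.slice 0 ρ, r_c < ‖(y : E3)‖ →
        W.h.inner y = (Kerr.data M 0 ρ hM.le).h.inner y ∧ W.k y = (Kerr.data M 0 ρ hM.le).k y)

end Summit.FinalStateConjecture.FinalStateConjecture.Cruxes.ParametricKerrBurial.Sketch3G2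

end
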